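import Literature.Geometry.Lorentzian.KerrSpinDerivatives
import Literature.Geometry.Lorentzian.KerrCylinderSpinExpansion
import Literature.Geometry.Lorentzian.SchwarzschildKerrSchildComponents
import Mathlib.Analysis.Calculus.FDeriv.Symmetric
import HarnessLib

/-!
# The first-order spin term of the second fundamental form of the Kerr cylinders
# (Li–Mei (4.2), second line)

Support file (all results proved; no named facts) for the named fact `LiMei.interiorKerrGluing`
(`InteriorKerrGluing.lean`; J. Li, H. Mei, *A construction of collapsing spacetimes in vacuum*,
Comm. Math. Phys. 378 (2020) = arXiv:2005.01249, Prop. 4.1). Li–Mei (4.2), second line: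

  `k̄_{m,a} = k̄_m − 2 m r₀⁻² sin²θ (2m/r₀ − 1)^{1/2} dt dφ + O(a²)`,

"both can be derived by direct computation". This file carries out the direct computation for
the tree's closed form `cylKRep` of the second fundamental form of the standard Kerr cylinder
(`KerrCylinderParameterClosenessK.lean`): `a ↦ cylKRep M a r₀ τ₀ 1 y v w` is differentiable at
`a = 0` with derivative

  `M (2M/r₀ − 1)^{1/2} / (r₀² ‖y‖³) · ((y₁v₀ − y₀v₁)⟪y, w⟫ + ⟪y, v⟫(y₁w₀ − y₀w₁))`

(`hasDerivAt_cylKRep_spin`), which is Li–Mei's `−2 m r₀⁻² sin²θ (2m/r₀−1)^{1/2} dt dφ` read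
through `dψ` (compare the `h`-term `hasDerivAt_cylH₀_spin` of `KerrCylinderSpinExpansion.lean`,
whose coefficient `−4m r₀⁻¹ sin²θ dt dφ ↦ 2m/(r₀‖y‖³)` fixes the dictionary; the ratio of the two
printed coefficients is `(2m/r₀ − 1)^{1/2}/(2r₀)`, as here).

Method. `cylKRep = g(D(n∘ψ)v, dψ w) + ½(∂_{dψv} g(n, dψw) + ∂_n g(dψw, dψv) − ∂_{dψw} g(dψv, n))`
is differentiated in `a` at `a = 0` term by term (`hasDerivAt_cylKRep_spin_abstract`): the
cylinder point `ψ_a(y)` and the frame `dψ_a` are stationary at `a = 0` (`r₀² + a²` is even); the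
first-order spin terms of `g` and of the unit normal `n` are those of `KerrSpinDerivatives.lean`;
the `a`-derivative of the `x`-derivatives `∂g_{M,a}`, `∂n_{M,a}` along the (stationary) cylinder is
the `x`-derivative of the first-order spin terms (Schwarz's theorem, `hasDerivAt_fderiv_curry_along`).
The resulting eight terms are then evaluated with the closed forms of the Schwarzschild fields and
of their first derivatives (`SchwarzschildKerrSchildComponents.lean`).

## References

* J. Li, H. Mei, arXiv:2005.01249, §4, (4.1)–(4.2) (key `LiMei2020`).
* R. P. Kerr, A. Schild (1965), §3; M. Visser, arXiv:0706.0622, (32)–(35) (key `KerrSchild1965`).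
-/

noncomputable section

open Set Filter Function Metric
open scoped ContDiff Topology RealInnerProductSpace

namespace Literature.Geometry.Lorentzian

attribute [local instance] instNormedAddCommGroupBilinE4 instNormedSpaceBilinE4

/-! ### Generic calculus: partial derivatives along a stationary curve -/

section MixedPartials

variable {E F : Type*} [NormedAddCommGroup E] [NormedSpace ℝ E] [NormedAddCommGroup F]
  [NormedSpace ℝ F]

/-- Partial derivative in the second slot = total derivative on `(0, U)`. [folklore] -/
theorem fderiv_curry_snd_slot_apply {Φ : ℝ × E → F} {a : ℝ} {z : E}
    (hΦ : DifferentiableAt ℝ Φ (a, z)) (U : E) :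
    fderiv ℝ (fun z ↦ Φ (a, z)) z U = fderiv ℝ Φ (a, z) (0, U) := by
  have h : HasFDerivAt (fun z ↦ Φ (a, z)) ((fderiv ℝ Φ (a, z)).comp (ContinuousLinearMap.inr ℝ ℝ E)) z :=
    hΦ.hasFDerivAt.comp z (hasFDerivAt_prodMk_right a z)
  rw [h.fderiv]
  rfl

/-- Partial derivative in the first (scalar) slot = total derivative on `(1, 0)`. [folklore] -/
theorem hasDerivAt_curry_fst_slot {Φ : ℝ × E → F} {a : ℝ} {z : E}
    (hΦ : DifferentiableAt ℝ Φ (a, z)) :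
    HasDerivAt (fun a ↦ Φ (a, z)) (fderiv ℝ Φ (a, z) (1, 0)) a := by
  have h : HasFDerivAt (fun a ↦ Φ (a, z)) ((fderiv ℝ Φ (a, z)).comp (ContinuousLinearMap.inl ℝ ℝ E)) a :=
    hΦ.hasFDerivAt.comp a (hasFDerivAt_prodMk_left a z)
  have h2 := h.hasDerivAt
  simpa using h2

/-- Along a curve `γ` with `γ(0) = x₀`, `γ'(0) = 0`, the derivative of `a ↦ Φ(a, γ(a))` at `0` is
the partial derivative `∂_a Φ(0, x₀)`. [folklore] -/
theorem hasDerivAt_along_of_partial {Φ : ℝ × E → F} {x₀ : E} {γ : ℝ → E} {D : F}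
    (hΦ : DifferentiableAt ℝ Φ (0, x₀)) (hγ : HasDerivAt γ 0 0) (hγ0 : γ 0 = x₀)
    (hD : HasDerivAt (fun a ↦ Φ (a, x₀)) D 0) :
    HasDerivAt (fun a ↦ Φ (a, γ a)) D 0 := by
  have hc0 : HasDerivAt (fun a : ℝ ↦ ((a, γ a) : ℝ × E)) ((1 : ℝ), (0 : E)) 0 :=
    (hasDerivAt_id' (0 : ℝ)).prodMk hγ
  have hΦ' : HasFDerivAt Φ (fderiv ℝ Φ (0, x₀)) ((fun a : ℝ ↦ ((a, γ a) : ℝ × E)) 0) := by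
    simp only [hγ0]; exact hΦ.hasFDerivAt
  have h := hΦ'.comp_hasDerivAt 0 hc0
  have e : fderiv ℝ Φ (0, x₀) ((1 : ℝ), (0 : E)) = D := (hasDerivAt_curry_fst_slot hΦ).unique hD
  rw [e] at h
  exact h

/-- **Differentiating a partial derivative along a stationary curve, mixed partials exchanged.**
For `Φ : ℝ × E → F` of class `C²` near `(0, x₀)`, a curve `γ` through `x₀` with `γ'(0) = 0` and
a vector curve `u`:
`d/da|₀ [D₂Φ(a, γ(a)) u(a)] = D[z ↦ D₁Φ(0, z)](x₀) u(0) + D₂Φ(0, x₀) u'(0)`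
(Schwarz's theorem, Mathlib's `ContDiffAt.isSymmSndFDerivAt`). [folklore] -/
theorem hasDerivAt_fderiv_curry_along {Φ : ℝ × E → F} {x₀ : E} {γ : ℝ → E} {u : ℝ → E} {u' : E}
    (hΦ : ContDiffAt ℝ 2 Φ (0, x₀)) (hγ : HasDerivAt γ 0 0) (hγ0 : γ 0 = x₀)
    (hu : HasDerivAt u u' 0) :
    HasDerivAt (fun a ↦ fderiv ℝ (fun z ↦ Φ (a, z)) (γ a) (u a))
      (fderiv ℝ (fun z ↦ fderiv ℝ Φ (0, z) (1, 0)) x₀ (u 0) +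
        fderiv ℝ (fun z ↦ Φ (0, z)) x₀ u') 0 := by
  have hΦ' : ∀ᶠ q in 𝓝 ((0 : ℝ), x₀), ContDiffAt ℝ 2 Φ q := hΦ.eventually (by simp)
  have hdiff : ∀ᶠ q in 𝓝 ((0 : ℝ), x₀), DifferentiableAt ℝ Φ q :=
    hΦ'.mono fun q hq ↦ hq.differentiableAt (by simp)
  have hD : DifferentiableAt ℝ (fderiv ℝ Φ) (0, x₀) :=
    (hΦ.fderiv_right (m := 1) (by norm_num)).differentiableAt one_ne_zero
  have hc0 : HasDerivAt (fun a : ℝ ↦ ((a, γ a) : ℝ × E)) ((1 : ℝ), (0 : E)) 0 :=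
    (hasDerivAt_id' (0 : ℝ)).prodMk hγ
  have hc0' : (fun a : ℝ ↦ ((a, γ a) : ℝ × E)) 0 = (0, x₀) := by simp [hγ0]
  have hcont : ContinuousAt (fun a : ℝ ↦ ((a, γ a) : ℝ × E)) 0 := hc0.continuousAt
  have hc : HasDerivAt (fun a : ℝ ↦ fderiv ℝ Φ (a, γ a))
      (fderiv ℝ (fderiv ℝ Φ) (0, x₀) ((1 : ℝ), (0 : E))) 0 := by
    have hD' : HasFDerivAt (fderiv ℝ Φ) (fderiv ℝ (fderiv ℝ Φ) (0, x₀))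
        ((fun a : ℝ ↦ ((a, γ a) : ℝ × E)) 0) := by
      rw [hc0']; exact hD.hasFDerivAt
    exact hD'.comp_hasDerivAt 0 hc0
  have hw : HasDerivAt (fun a : ℝ ↦ ((0 : ℝ), u a)) ((0 : ℝ), u') 0 :=
    (hasDerivAt_const (0 : ℝ) (0 : ℝ)).prodMk hu
  have h := hc.clm_apply hw
  have hev : (fun a ↦ fderiv ℝ (fun z ↦ Φ (a, z)) (γ a) (u a)) =ᶠ[𝓝 0]
      fun a ↦ fderiv ℝ Φ (a, γ a) ((0 : ℝ), u a) := by
    have h1 : ∀ᶠ a : ℝ in 𝓝 0, DifferentiableAt ℝ Φ (a, γ a) :=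
      hcont.eventually (by rw [hc0']; exact hdiff)
    filter_upwards [h1] with a ha
    exact fderiv_curry_snd_slot_apply ha (u a)
  refine (h.congr_of_eventuallyEq hev).congr_deriv ?_
  simp only [hγ0]
  congr 1
  · have hsymm : IsSymmSndFDerivAt ℝ Φ (0, x₀) := hΦ.isSymmSndFDerivAt (by simp)
    rw [hsymm ((1 : ℝ), (0 : E)) ((0 : ℝ), u 0)]
    have h1 : fderiv ℝ (fun q ↦ fderiv ℝ Φ q ((1 : ℝ), (0 : E))) (0, x₀) ((0 : ℝ), u 0) =
        fderiv ℝ (fderiv ℝ Φ) (0, x₀) ((0 : ℝ), u 0) ((1 : ℝ), (0 : E)) := by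
      rw [fderiv_clm_apply hD (differentiableAt_const _)]
      simp
    have h2 : DifferentiableAt ℝ (fun q ↦ fderiv ℝ Φ q ((1 : ℝ), (0 : E))) (0, x₀) :=
      hD.clm_apply (differentiableAt_const _)
    rw [← h1, ← fderiv_curry_snd_slot_apply h2]
  · exact (fderiv_curry_snd_slot_apply hdiff.self_of_nhds u').symm

/-- The same, with the first-order field `S(z) = ∂_a Φ(0, z)` identified near `x₀`. [folklore] -/
theorem hasDerivAt_fderiv_curry_along' {Φ : ℝ × E → F} {x₀ : E} {γ : ℝ → E} {u : ℝ → E} {u' : E}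
    {S : E → F} (hΦ : ContDiffAt ℝ 2 Φ (0, x₀)) (hγ : HasDerivAt γ 0 0) (hγ0 : γ 0 = x₀)
    (hu : HasDerivAt u u' 0) (hS : ∀ᶠ z in 𝓝 x₀, HasDerivAt (fun a ↦ Φ (a, z)) (S z) 0) :
    HasDerivAt (fun a ↦ fderiv ℝ (fun z ↦ Φ (a, z)) (γ a) (u a))
      (fderiv ℝ S x₀ (u 0) + fderiv ℝ (fun z ↦ Φ (0, z)) x₀ u') 0 := by
  have h := hasDerivAt_fderiv_curry_along hΦ hγ hγ0 hu
  have hdiff : ∀ᶠ z in 𝓝 x₀, DifferentiableAt ℝ Φ (0, z) := by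
    have h1 : ∀ᶠ q in 𝓝 ((0 : ℝ), x₀), DifferentiableAt ℝ Φ q :=
      (hΦ.eventually (by simp)).mono fun q hq ↦ hq.differentiableAt (by simp)
    exact (continuousAt_const.prodMk continuousAt_id).eventually
      (by simpa using h1)
  have hev : (fun z ↦ fderiv ℝ Φ (0, z) (1, 0)) =ᶠ[𝓝 x₀] S := by
    filter_upwards [hdiff, hS] with z hz hSz
    exact (hasDerivAt_curry_fst_slot hz).unique hSz
  rw [hev.fderiv_eq] at h
  exact h

/-- The first-order field `S(z) = ∂_a Φ(0, z)` of a `C²` map is differentiable. [folklore] -/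
theorem differentiableAt_partialField {Φ : ℝ × E → F} {x₀ : E} {S : E → F}
    (hΦ : ContDiffAt ℝ 2 Φ (0, x₀)) (hS : ∀ᶠ z in 𝓝 x₀, HasDerivAt (fun a ↦ Φ (a, z)) (S z) 0) :
    DifferentiableAt ℝ S x₀ := by
  have hD : DifferentiableAt ℝ (fderiv ℝ Φ) (0, x₀) :=
    (hΦ.fderiv_right (m := 1) (by norm_num)).differentiableAt one_ne_zero
  have hdiff : ∀ᶠ z in 𝓝 x₀, DifferentiableAt ℝ Φ (0, z) := by
    have h1 : ∀ᶠ q in 𝓝 ((0 : ℝ), x₀), DifferentiableAt ℝ Φ q :=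
      (hΦ.eventually (by simp)).mono fun q hq ↦ hq.differentiableAt (by simp)
    exact (continuousAt_const.prodMk continuousAt_id).eventually (by simpa using h1)
  have hev : (fun z ↦ fderiv ℝ Φ (0, z) (1, 0)) =ᶠ[𝓝 x₀] S := by
    filter_upwards [hdiff, hS] with z hz hSz
    exact (hasDerivAt_curry_fst_slot hz).unique hSz
  have h2 : DifferentiableAt ℝ (fun z : E ↦ fderiv ℝ Φ (0, z) ((1 : ℝ), (0 : E))) x₀ := by
    have hc : DifferentiableAt ℝ (fun z : E ↦ fderiv ℝ Φ (((0 : ℝ), z) : ℝ × E)) x₀ := by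
      have hf : DifferentiableAt ℝ (fun z : E ↦ (((0 : ℝ), z) : ℝ × E)) x₀ :=
        (differentiableAt_const _).prodMk differentiableAt_id
      have h := hD.comp x₀ hf
      exact h
    exact hc.clm_apply (differentiableAt_const _)
  exact h2.congr_of_eventuallyEq hev.symm

/-- The same for a stationary vector curve (`u'(0) = 0`). [folklore] -/
theorem hasDerivAt_fderiv_curry_along₀ {Φ : ℝ × E → F} {x₀ : E} {γ : ℝ → E} {u : ℝ → E}
    {S : E → F} (hΦ : ContDiffAt ℝ 2 Φ (0, x₀)) (hγ : HasDerivAt γ 0 0) (hγ0 : γ 0 = x₀)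
    (hu : HasDerivAt u 0 0) (hS : ∀ᶠ z in 𝓝 x₀, HasDerivAt (fun a ↦ Φ (a, z)) (S z) 0) :
    HasDerivAt (fun a ↦ fderiv ℝ (fun z ↦ Φ (a, z)) (γ a) (u a)) (fderiv ℝ S x₀ (u 0)) 0 := by
  have h := hasDerivAt_fderiv_curry_along' hΦ hγ hγ0 hu hS
  rw [map_zero, add_zero] at h
  exact h

end MixedPartials

namespace LiMei

/-! ### The cylinder point and frame are stationary in the spin at `a = 0` -/

/-- `√(r₀² + a²)` is even: zero spin derivative at `a = 0` (`r₀ ≠ 0`). [folklore] -/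
theorem hasDerivAt_sqrt_sq_add_sq {r₀ : ℝ} (hr₀ : r₀ ≠ 0) :
    HasDerivAt (fun a : ℝ ↦ Real.sqrt (r₀ ^ 2 + a ^ 2)) 0 0 := by
  have h0 : r₀ ^ 2 + (0 : ℝ) ^ 2 ≠ 0 := by positivity
  have h := (((hasDerivAt_id' (0 : ℝ)).pow 2).const_add (r₀ ^ 2)).sqrt h0
  exact h.congr_deriv (by simp)

/-- The ellipsoid point split into its spin-dependent planar part and its axial part. [folklore] -/
theorem ellipsoidPt_eq_smul_add (r₀ a : ℝ) (n : E3) :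
    ellipsoidPt r₀ a n = Real.sqrt (r₀ ^ 2 + a ^ 2) •
        (n 0 • EuclideanSpace.single 0 1 + n 1 • EuclideanSpace.single 1 1) +
      (r₀ * n 2) • EuclideanSpace.single (2 : Fin 3) (1 : ℝ) := by
  ext i
  fin_cases i <;> simp [ellipsoidPt]

/-- `∂_a ellipsoidPt r₀ a n |_{a=0} = 0`. [folklore] -/
theorem hasDerivAt_ellipsoidPt_spin {r₀ : ℝ} (hr₀ : r₀ ≠ 0) (n : E3) :
    HasDerivAt (fun a : ℝ ↦ ellipsoidPt r₀ a n) 0 0 := by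
  have e : (fun a : ℝ ↦ ellipsoidPt r₀ a n) = fun a ↦ Real.sqrt (r₀ ^ 2 + a ^ 2) •
        (n 0 • EuclideanSpace.single 0 1 + n 1 • EuclideanSpace.single 1 1) +
      (r₀ * n 2) • EuclideanSpace.single (2 : Fin 3) (1 : ℝ) :=
    funext fun a ↦ ellipsoidPt_eq_smul_add r₀ a n
  rw [e]
  have h := ((hasDerivAt_sqrt_sq_add_sq hr₀).smul_const
    (n 0 • EuclideanSpace.single 0 1 + n 1 • EuclideanSpace.single (1 : Fin 3) (1 : ℝ))).add_const
    ((r₀ * n 2) • EuclideanSpace.single (2 : Fin 3) (1 : ℝ))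
  exact h.congr_deriv (by simp)

/-- **The cylinder point is stationary in the spin**: `∂_a ψ_a(y)|_{a=0} = 0`. [folklore] -/
theorem hasDerivAt_kerrCylMap_spin {r₀ : ℝ} (hr₀ : r₀ ≠ 0) (τ₀ : ℝ) (y : E3) :
    HasDerivAt (fun a : ℝ ↦ kerrCylMap r₀ a τ₀ LinearIsometry.id y) 0 0 := by
  have e : (fun a : ℝ ↦ kerrCylMap r₀ a τ₀ LinearIsometry.id y) =
      fun a ↦ (‖y‖ + τ₀) • E4.basisVector 0 + E4.spaceEmbed (ellipsoidPt r₀ a (‖y‖⁻¹ • y)) := by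
    funext a; rw [kerrCylMap_eq]; rfl
  rw [e]
  have h := (E4.spaceEmbed.hasFDerivAt.comp_hasDerivAt 0
    (hasDerivAt_ellipsoidPt_spin hr₀ (‖y‖⁻¹ • y))).const_add ((‖y‖ + τ₀) • E4.basisVector 0)
  exact h.congr_deriv (map_zero _)

/-- **The frame is stationary in the spin**: `∂_a dψ_a(y) v|_{a=0} = 0`. [folklore] -/
theorem hasDerivAt_kerrCylDeriv_spin {r₀ : ℝ} (hr₀ : r₀ ≠ 0) (y v : E3) :
    HasDerivAt (fun a : ℝ ↦ kerrCylDeriv r₀ a LinearIsometry.id y v) 0 0 := by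
  have e : (fun a : ℝ ↦ kerrCylDeriv r₀ a LinearIsometry.id y v) =
      fun a ↦ (‖y‖⁻¹ * ⟪y, v⟫) • E4.basisVector 0 + E4.spaceEmbed (ellipsoidPt r₀ a (tanVec y v)) := by
    funext a; rw [kerrCylDeriv_apply]; rfl
  rw [e]
  have h := (E4.spaceEmbed.hasFDerivAt.comp_hasDerivAt 0
    (hasDerivAt_ellipsoidPt_spin hr₀ (tanVec y v))).const_add ((‖y‖⁻¹ * ⟪y, v⟫) • E4.basisVector 0)
  exact h.congr_deriv (map_zero _)

/-! ### Joint smoothness and the cylinder at small spin -/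

/-- `(a, x) ↦ g_{M,a}(x)` is jointly smooth where `r > 0`. [folklore] -/
theorem contDiffAt_bilin_spin₂ (M : ℝ) {q : ℝ × E4} (hq : 0 < Kerr.radius q.1 q.2) {n : ℕ∞ω} :
    ContDiffAt ℝ n (fun q : ℝ × E4 ↦ Kerr.bilin M q.1 q.2) q := by
  have hg := Kerr.contDiffAt_bilin₃ (q := (M, q)) hq (n := n)
  have hf : ContDiffAt ℝ n (fun q : ℝ × E4 ↦ ((M, q) : ℝ × ℝ × E4)) q :=
    contDiffAt_const.prodMk contDiffAt_id
  have h := hg.comp q hf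
  exact h

/-- `(a, x) ↦ n_{M,a}(x)` is jointly smooth where `r > 0` and `g(g♯dr, g♯dr) < 0`. [folklore] -/
theorem contDiffAt_kerrCylUnitNormal_spin₂ (M : ℝ) {q : ℝ × E4} (hq : 0 < Kerr.radius q.1 q.2)
    (hneg : Kerr.bilin M q.1 q.2 (Kerr.radiusSharp M q.1 q.2) (Kerr.radiusSharp M q.1 q.2) < 0)
    {n : ℕ∞ω} : ContDiffAt ℝ n (fun q : ℝ × E4 ↦ kerrCylUnitNormal M q.1 q.2) q := by
  have hg := contDiffAt_kerrCylUnitNormal₃ (q := (M, q)) hq hneg (n := n)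
  have hf : ContDiffAt ℝ n (fun q : ℝ × E4 ↦ ((M, q) : ℝ × ℝ × E4)) q :=
    contDiffAt_const.prodMk contDiffAt_id
  have h := hg.comp q hf
  exact h

/-- The first-order spin term of the unit normal of the cylinders as a field,
`ν₁(x) = −(−g(g♯dr, g♯dr))^{-1/2} 2H δℓ♯` at `a = 0`. [cite: LiMei2020, (4.2)] -/
def spinCylNormal (M : ℝ) (x : E4) : E4 :=
  -(((Real.sqrt (-Kerr.bilin M 0 x (Kerr.radiusSharp M 0 x) (Kerr.radiusSharp M 0 x)))⁻¹ *
    (2 * Kerr.scalarH M 0 x)) • Kerr.spinNullVector x)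

/-- `∂_a n_{M,a}(x)|_{a=0} = ν₁(x)` (restating `hasDerivAt_kerrCylUnitNormal_spin`). [cite: LiMei2020, (4.2)] -/
theorem hasDerivAt_kerrCylUnitNormal_spin' (M : ℝ) {x : E4} (hx : 0 < Kerr.radius 0 x)
    (hq : Kerr.bilin M 0 x (Kerr.radiusSharp M 0 x) (Kerr.radiusSharp M 0 x) < 0) :
    HasDerivAt (fun a : ℝ ↦ kerrCylUnitNormal M a x) (spinCylNormal M x) 0 :=
  hasDerivAt_kerrCylUnitNormal_spin M hx hq

section Cylinder

variable {M r₀ : ℝ} (hr₀ : 0 < r₀) (h2M : r₀ < 2 * M) (τ₀ : ℝ) {y : E3} (hy : y ≠ 0)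
include hr₀ h2M hy

omit h2M in
/-- On the standard cylinder, `r = r₀ > 0` at every spin. [folklore] -/
theorem radius_cyl_pos (a : ℝ) : 0 < Kerr.radius a (kerrCylMap r₀ a τ₀ LinearIsometry.id y) := by
  rw [radius_kerrCylMap hr₀.le a τ₀ _ hy]; exact hr₀

/-- On the standard cylinder, `g(g♯dr, g♯dr) < 0` for small spin (`Δ_{M,a}(r₀) < 0`). [folklore] -/
theorem eventually_bilin_radiusSharp_cyl_neg :
    ∀ᶠ a : ℝ in 𝓝 0, Kerr.bilin M a (kerrCylMap r₀ a τ₀ LinearIsometry.id y)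
      (Kerr.radiusSharp M a (kerrCylMap r₀ a τ₀ LinearIsometry.id y))
      (Kerr.radiusSharp M a (kerrCylMap r₀ a τ₀ LinearIsometry.id y)) < 0 := by
  have hΔ0 : r₀ ^ 2 - 2 * M * r₀ + (0 : ℝ) ^ 2 < 0 := by nlinarith
  have hc : ContinuousAt (fun a : ℝ ↦ r₀ ^ 2 - 2 * M * r₀ + a ^ 2) 0 := by fun_prop
  have hev : ∀ᶠ a : ℝ in 𝓝 0, r₀ ^ 2 - 2 * M * r₀ + a ^ 2 < 0 := hc.eventually (gt_mem_nhds hΔ0)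
  filter_upwards [hev] with a ha
  exact bilin_radiusSharp_self_neg_of_delta_neg hr₀ ha τ₀ _ hy

/-- At `a = 0`: `g(g♯dr, g♯dr) < 0` on the cylinder. [folklore] -/
theorem bilin_radiusSharp_cyl_neg_zero :
    Kerr.bilin M 0 (kerrCylMap r₀ 0 τ₀ LinearIsometry.id y)
      (Kerr.radiusSharp M 0 (kerrCylMap r₀ 0 τ₀ LinearIsometry.id y))
      (Kerr.radiusSharp M 0 (kerrCylMap r₀ 0 τ₀ LinearIsometry.id y)) < 0 :=
  (eventually_bilin_radiusSharp_cyl_neg hr₀ h2M τ₀ hy).self_of_nhds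

omit h2M in
/-- **`∂_a [g_{M,a}(ψ_a y)]|_{a=0} = (∂_a g)(ψ_0 y)`** (the point is stationary). [cite: LiMei2020, (4.2)] -/
theorem hasDerivAt_bilin_cyl_spin :
    HasDerivAt (fun a : ℝ ↦ Kerr.bilin M a (kerrCylMap r₀ a τ₀ LinearIsometry.id y))
      (Kerr.spinMetric M (kerrCylMap r₀ 0 τ₀ LinearIsometry.id y)) 0 := by
  have hx := radius_cyl_pos hr₀ τ₀ hy 0
  have hΦ := (contDiffAt_bilin_spin₂ M (q := ((0 : ℝ), kerrCylMap r₀ 0 τ₀ LinearIsometry.id y)) hx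
    (n := 1)).differentiableAt one_ne_zero
  exact hasDerivAt_along_of_partial (Φ := fun q : ℝ × E4 ↦ Kerr.bilin M q.1 q.2) hΦ
    (hasDerivAt_kerrCylMap_spin hr₀.ne' τ₀ y) rfl (Kerr.hasDerivAt_bilin_spin M hx)

/-- **`∂_a [n_{M,a}(ψ_a y)]|_{a=0} = ν₁(ψ_0 y)`**. [cite: LiMei2020, (4.2)] -/
theorem hasDerivAt_kerrCylUnitNormal_cyl_spin :
    HasDerivAt (fun a : ℝ ↦ kerrCylUnitNormal M a (kerrCylMap r₀ a τ₀ LinearIsometry.id y))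
      (spinCylNormal M (kerrCylMap r₀ 0 τ₀ LinearIsometry.id y)) 0 := by
  have hx := radius_cyl_pos hr₀ τ₀ hy 0
  have hq := bilin_radiusSharp_cyl_neg_zero hr₀ h2M τ₀ hy
  have hΦ := (contDiffAt_kerrCylUnitNormal_spin₂ M
    (q := ((0 : ℝ), kerrCylMap r₀ 0 τ₀ LinearIsometry.id y)) hx hq (n := 1)).differentiableAt
    one_ne_zero
  exact hasDerivAt_along_of_partial (Φ := fun q : ℝ × E4 ↦ kerrCylUnitNormal M q.1 q.2) hΦ
    (hasDerivAt_kerrCylMap_spin hr₀.ne' τ₀ y) rfl (hasDerivAt_kerrCylUnitNormal_spin' M hx hq)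

omit h2M in
/-- The spin derivative of the metric, pointwise near the cylinder point. [folklore] -/
theorem eventually_hasDerivAt_bilin_spin :
    ∀ᶠ z in 𝓝 (kerrCylMap r₀ 0 τ₀ LinearIsometry.id y),
      HasDerivAt (fun a : ℝ ↦ Kerr.bilin M a z) (Kerr.spinMetric M z) 0 := by
  have hx := radius_cyl_pos hr₀ τ₀ hy 0
  have hopen : IsOpen {z : E4 | 0 < Kerr.radius 0 z} :=
    isOpen_lt continuous_const (Kerr.continuous_radius 0)
  filter_upwards [hopen.mem_nhds hx] with z hz
  exact Kerr.hasDerivAt_bilin_spin M hz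

/-- The spin derivative of the unit normal, pointwise near the cylinder point. [folklore] -/
theorem eventually_hasDerivAt_kerrCylUnitNormal_spin :
    ∀ᶠ z in 𝓝 (kerrCylMap r₀ 0 τ₀ LinearIsometry.id y),
      HasDerivAt (fun a : ℝ ↦ kerrCylUnitNormal M a z) (spinCylNormal M z) 0 := by
  have hx := radius_cyl_pos hr₀ τ₀ hy 0
  have hq := bilin_radiusSharp_cyl_neg_zero hr₀ h2M τ₀ hy
  have hopen : IsOpen {z : E4 | 0 < Kerr.radius 0 z} :=
    isOpen_lt continuous_const (Kerr.continuous_radius 0)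
  have hc : ContinuousAt (fun z : E4 ↦ Kerr.bilin M 0 z (Kerr.radiusSharp M 0 z)
      (Kerr.radiusSharp M 0 z)) (kerrCylMap r₀ 0 τ₀ LinearIsometry.id y) :=
    (Kerr.contDiffAt_bilin_radiusSharp_self M hx (n := 0)).continuousAt
  filter_upwards [hopen.mem_nhds hx, hc.eventually (gt_mem_nhds hq)] with z hz hqz
  exact hasDerivAt_kerrCylUnitNormal_spin' M hz hqz

omit h2M in
/-- **The spin derivative of `∂g` along the cylinder**:
`d/da|₀ [∂_{u(a)} g_{M,a}(ψ_a y)] = ∂_{u(0)}(∂_a g)(ψ_0 y) + ∂_{u'(0)} g_{M,0}(ψ_0 y)`. [cite: LiMei2020, (4.2)] -/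
theorem hasDerivAt_fderiv_bilin_cyl_spin {u : ℝ → E4} {u' : E4} (hu : HasDerivAt u u' 0) :
    HasDerivAt (fun a : ℝ ↦ fderiv ℝ (Kerr.bilin M a) (kerrCylMap r₀ a τ₀ LinearIsometry.id y) (u a))
      (fderiv ℝ (Kerr.spinMetric M) (kerrCylMap r₀ 0 τ₀ LinearIsometry.id y) (u 0) +
        fderiv ℝ (Kerr.bilin M 0) (kerrCylMap r₀ 0 τ₀ LinearIsometry.id y) u') 0 := by
  have hx := radius_cyl_pos hr₀ τ₀ hy 0
  have hΦ := contDiffAt_bilin_spin₂ M (q := ((0 : ℝ), kerrCylMap r₀ 0 τ₀ LinearIsometry.id y)) hx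
    (n := 2)
  exact hasDerivAt_fderiv_curry_along' (Φ := fun q : ℝ × E4 ↦ Kerr.bilin M q.1 q.2) hΦ
    (hasDerivAt_kerrCylMap_spin hr₀.ne' τ₀ y) rfl hu
    (eventually_hasDerivAt_bilin_spin (M := M) hr₀ τ₀ hy)

/-- **The spin derivative of `∂n` along the cylinder**:
`d/da|₀ [∂_{u(a)} n_{M,a}(ψ_a y)] = ∂_{u(0)} ν₁(ψ_0 y) + ∂_{u'(0)} n_{M,0}(ψ_0 y)`. [cite: LiMei2020, (4.2)] -/
theorem hasDerivAt_fderiv_kerrCylUnitNormal_cyl_spin {u : ℝ → E4} {u' : E4} (hu : HasDerivAt u u' 0) :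
    HasDerivAt (fun a : ℝ ↦ fderiv ℝ (kerrCylUnitNormal M a) (kerrCylMap r₀ a τ₀ LinearIsometry.id y) (u a))
      (fderiv ℝ (spinCylNormal M) (kerrCylMap r₀ 0 τ₀ LinearIsometry.id y) (u 0) +
        fderiv ℝ (kerrCylUnitNormal M 0) (kerrCylMap r₀ 0 τ₀ LinearIsometry.id y) u') 0 := by
  have hx := radius_cyl_pos hr₀ τ₀ hy 0
  have hq := bilin_radiusSharp_cyl_neg_zero hr₀ h2M τ₀ hy
  have hΦ := contDiffAt_kerrCylUnitNormal_spin₂ M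
    (q := ((0 : ℝ), kerrCylMap r₀ 0 τ₀ LinearIsometry.id y)) hx hq (n := 2)
  exact hasDerivAt_fderiv_curry_along' (Φ := fun q : ℝ × E4 ↦ kerrCylUnitNormal M q.1 q.2) hΦ
    (hasDerivAt_kerrCylMap_spin hr₀.ne' τ₀ y) rfl hu
    (eventually_hasDerivAt_kerrCylUnitNormal_spin hr₀ h2M τ₀ hy)

omit h2M in
/-- `d/da|₀ [∂_{u(a)} g_{M,a}(ψ_a y)] = ∂_{u(0)}(∂_a g)(ψ_0 y)` for a stationary `u`. [cite: LiMei2020, (4.2)] -/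
theorem hasDerivAt_fderiv_bilin_cyl_spin₀ {u : ℝ → E4} (hu : HasDerivAt u 0 0) :
    HasDerivAt (fun a : ℝ ↦ fderiv ℝ (Kerr.bilin M a) (kerrCylMap r₀ a τ₀ LinearIsometry.id y) (u a))
      (fderiv ℝ (Kerr.spinMetric M) (kerrCylMap r₀ 0 τ₀ LinearIsometry.id y) (u 0)) 0 := by
  have hx := radius_cyl_pos hr₀ τ₀ hy 0
  have hΦ := contDiffAt_bilin_spin₂ M (q := ((0 : ℝ), kerrCylMap r₀ 0 τ₀ LinearIsometry.id y)) hx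
    (n := 2)
  exact hasDerivAt_fderiv_curry_along₀ (Φ := fun q : ℝ × E4 ↦ Kerr.bilin M q.1 q.2) hΦ
    (hasDerivAt_kerrCylMap_spin hr₀.ne' τ₀ y) rfl hu
    (eventually_hasDerivAt_bilin_spin (M := M) hr₀ τ₀ hy)

/-- `d/da|₀ [∂_{u(a)} n_{M,a}(ψ_a y)] = ∂_{u(0)} ν₁(ψ_0 y)` for a stationary `u`. [cite: LiMei2020, (4.2)] -/
theorem hasDerivAt_fderiv_kerrCylUnitNormal_cyl_spin₀ {u : ℝ → E4} (hu : HasDerivAt u 0 0) :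
    HasDerivAt (fun a : ℝ ↦ fderiv ℝ (kerrCylUnitNormal M a) (kerrCylMap r₀ a τ₀ LinearIsometry.id y) (u a))
      (fderiv ℝ (spinCylNormal M) (kerrCylMap r₀ 0 τ₀ LinearIsometry.id y) (u 0)) 0 := by
  have hx := radius_cyl_pos hr₀ τ₀ hy 0
  have hq := bilin_radiusSharp_cyl_neg_zero hr₀ h2M τ₀ hy
  have hΦ := contDiffAt_kerrCylUnitNormal_spin₂ M
    (q := ((0 : ℝ), kerrCylMap r₀ 0 τ₀ LinearIsometry.id y)) hx hq (n := 2)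
  exact hasDerivAt_fderiv_curry_along₀ (Φ := fun q : ℝ × E4 ↦ kerrCylUnitNormal M q.1 q.2) hΦ
    (hasDerivAt_kerrCylMap_spin hr₀.ne' τ₀ y) rfl hu
    (eventually_hasDerivAt_kerrCylUnitNormal_spin hr₀ h2M τ₀ hy)

/-- The first slot of `cylKRep`, `D(n ∘ ψ_a)(y) v = ∂_{dψ_a v} n_{M,a}(ψ_a y)` (chain rule), for small
spin. [folklore] -/
theorem eventually_fderiv_unitNormal_comp (v : E3) :
    ∀ᶠ a : ℝ in 𝓝 0, fderiv ℝ (fun z : E3 ↦ kerrCylUnitNormal M a (kerrCylMap r₀ a τ₀ LinearIsometry.id z)) y v =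
      fderiv ℝ (kerrCylUnitNormal M a) (kerrCylMap r₀ a τ₀ LinearIsometry.id y)
        (kerrCylDeriv r₀ a LinearIsometry.id y v) := by
  filter_upwards [eventually_bilin_radiusSharp_cyl_neg hr₀ h2M τ₀ hy] with a ha
  have hx := radius_cyl_pos hr₀ τ₀ hy a
  have hN : DifferentiableAt ℝ (kerrCylUnitNormal M a) (kerrCylMap r₀ a τ₀ LinearIsometry.id y) :=
    (contDiffAt_kerrCylUnitNormal hx ha (n := 1)).differentiableAt one_ne_zero
  have hψ := hasFDerivAt_kerrCylMap r₀ a τ₀ LinearIsometry.id hy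
  have h : HasFDerivAt (fun z : E3 ↦ kerrCylUnitNormal M a (kerrCylMap r₀ a τ₀ LinearIsometry.id z))
      ((fderiv ℝ (kerrCylUnitNormal M a) (kerrCylMap r₀ a τ₀ LinearIsometry.id y)).comp
        (kerrCylDeriv r₀ a LinearIsometry.id y)) y :=
    hN.hasFDerivAt.comp y hψ
  rw [h.fderiv]
  rfl

/-- **The spin derivative of the second fundamental form of the Kerr cylinders, abstract form.**
With `x₀ = ψ_0(y)`, `V₀ = dψ_0 v`, `W₀ = dψ_0 w`, `n₀ = n_{M,0}(x₀)`, `ν₁ = ∂_a n|₀(x₀)`,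
`σ = ∂_a g|₀` (field), `g₀ = g_{M,0}`:
`d/da|₀ cylKRep = σ(x₀)(∂_{V₀}n₀, W₀) + g₀(∂_{V₀}ν₁, W₀)
  + ½(∂_{V₀}σ(n₀, W₀) + ∂_{V₀}g₀(ν₁, W₀) + ∂_{n₀}σ(W₀, V₀) + ∂_{ν₁}g₀(W₀, V₀)
      − ∂_{W₀}σ(V₀, n₀) − ∂_{W₀}g₀(V₀, ν₁))`. [cite: LiMei2020, (4.2)] -/
theorem hasDerivAt_cylKRep_spin_abstract (v w : E3) :
    HasDerivAt (fun a : ℝ ↦ cylKRep M a r₀ τ₀ LinearIsometry.id y v w)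
      (Kerr.spinMetric M (kerrCylMap r₀ 0 τ₀ LinearIsometry.id y)
          (fderiv ℝ (kerrCylUnitNormal M 0) (kerrCylMap r₀ 0 τ₀ LinearIsometry.id y)
            (kerrCylDeriv r₀ 0 LinearIsometry.id y v))
          (kerrCylDeriv r₀ 0 LinearIsometry.id y w) +
        Kerr.bilin M 0 (kerrCylMap r₀ 0 τ₀ LinearIsometry.id y)
          (fderiv ℝ (spinCylNormal M) (kerrCylMap r₀ 0 τ₀ LinearIsometry.id y)
            (kerrCylDeriv r₀ 0 LinearIsometry.id y v))
          (kerrCylDeriv r₀ 0 LinearIsometry.id y w) +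
        2⁻¹ * (fderiv ℝ (Kerr.spinMetric M) (kerrCylMap r₀ 0 τ₀ LinearIsometry.id y)
              (kerrCylDeriv r₀ 0 LinearIsometry.id y v)
              (kerrCylUnitNormal M 0 (kerrCylMap r₀ 0 τ₀ LinearIsometry.id y))
              (kerrCylDeriv r₀ 0 LinearIsometry.id y w) +
          fderiv ℝ (Kerr.bilin M 0) (kerrCylMap r₀ 0 τ₀ LinearIsometry.id y)
              (kerrCylDeriv r₀ 0 LinearIsometry.id y v)
              (spinCylNormal M (kerrCylMap r₀ 0 τ₀ LinearIsometry.id y))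
              (kerrCylDeriv r₀ 0 LinearIsometry.id y w) +
          (fderiv ℝ (Kerr.spinMetric M) (kerrCylMap r₀ 0 τ₀ LinearIsometry.id y)
                (kerrCylUnitNormal M 0 (kerrCylMap r₀ 0 τ₀ LinearIsometry.id y))
                (kerrCylDeriv r₀ 0 LinearIsometry.id y w) (kerrCylDeriv r₀ 0 LinearIsometry.id y v) +
            fderiv ℝ (Kerr.bilin M 0) (kerrCylMap r₀ 0 τ₀ LinearIsometry.id y)
                (spinCylNormal M (kerrCylMap r₀ 0 τ₀ LinearIsometry.id y))
                (kerrCylDeriv r₀ 0 LinearIsometry.id y w) (kerrCylDeriv r₀ 0 LinearIsometry.id y v)) -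
          (fderiv ℝ (Kerr.spinMetric M) (kerrCylMap r₀ 0 τ₀ LinearIsometry.id y)
                (kerrCylDeriv r₀ 0 LinearIsometry.id y w) (kerrCylDeriv r₀ 0 LinearIsometry.id y v)
                (kerrCylUnitNormal M 0 (kerrCylMap r₀ 0 τ₀ LinearIsometry.id y)) +
            fderiv ℝ (Kerr.bilin M 0) (kerrCylMap r₀ 0 τ₀ LinearIsometry.id y)
                (kerrCylDeriv r₀ 0 LinearIsometry.id y w) (kerrCylDeriv r₀ 0 LinearIsometry.id y v)
                (spinCylNormal M (kerrCylMap r₀ 0 τ₀ LinearIsometry.id y))))) 0 := by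
  -- the curves and their spin derivatives at `a = 0`
  have hV := hasDerivAt_kerrCylDeriv_spin hr₀.ne' y v
  have hW := hasDerivAt_kerrCylDeriv_spin hr₀.ne' y w
  have hG := hasDerivAt_bilin_cyl_spin (M := M) hr₀ τ₀ hy
  have hN := hasDerivAt_kerrCylUnitNormal_cyl_spin hr₀ h2M τ₀ hy
  have hDgV := hasDerivAt_fderiv_bilin_cyl_spin₀ (M := M) hr₀ τ₀ hy hV
  have hDgW := hasDerivAt_fderiv_bilin_cyl_spin₀ (M := M) hr₀ τ₀ hy hW
  have hDgN := hasDerivAt_fderiv_bilin_cyl_spin (M := M) hr₀ τ₀ hy hN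
  have hDN := hasDerivAt_fderiv_kerrCylUnitNormal_cyl_spin₀ hr₀ h2M τ₀ hy hV
  -- the four terms
  have hT1 := (hG.clm_apply (hDN.congr_of_eventuallyEq
    (eventually_fderiv_unitNormal_comp hr₀ h2M τ₀ hy v))).clm_apply hW
  have hT2 := (hDgV.clm_apply hN).clm_apply hW
  have hT3 := (hDgN.clm_apply hW).clm_apply hV
  have hT4 := (hDgW.clm_apply hV).clm_apply hN
  have h := hT1.add (((hT2.add hT3).sub hT4).const_mul 2⁻¹)
  refine (h.congr_of_eventuallyEq (Eventually.of_forall fun a ↦ rfl)).congr_deriv ?_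
  -- the value at `a = 0` of the first slot is `∂_{V₀} n₀`
  have e1 : fderiv ℝ (fun z : E3 ↦ kerrCylUnitNormal M 0 (kerrCylMap r₀ 0 τ₀ LinearIsometry.id z)) y v =
      fderiv ℝ (kerrCylUnitNormal M 0) (kerrCylMap r₀ 0 τ₀ LinearIsometry.id y)
        (kerrCylDeriv r₀ 0 LinearIsometry.id y v) :=
    (eventually_fderiv_unitNormal_comp hr₀ h2M τ₀ hy v).self_of_nhds
  simp only [map_zero, add_zero, add_apply, e1]

omit h2M in
/-- The first-order spin fields `σ = ∂_a g|₀` and `ν₁ = ∂_a n|₀` are differentiable at the cylinder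
point. [folklore] -/
theorem differentiableAt_spinMetric_cyl :
    DifferentiableAt ℝ (Kerr.spinMetric M) (kerrCylMap r₀ 0 τ₀ LinearIsometry.id y) := by
  have hx := radius_cyl_pos hr₀ τ₀ hy 0
  have hΦ := contDiffAt_bilin_spin₂ M (q := ((0 : ℝ), kerrCylMap r₀ 0 τ₀ LinearIsometry.id y)) hx
    (n := 2)
  exact differentiableAt_partialField (Φ := fun q : ℝ × E4 ↦ Kerr.bilin M q.1 q.2) hΦ
    (eventually_hasDerivAt_bilin_spin (M := M) hr₀ τ₀ hy)

/-- See `differentiableAt_spinMetric_cyl`. [folklore] -/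
theorem differentiableAt_spinCylNormal_cyl :
    DifferentiableAt ℝ (spinCylNormal M) (kerrCylMap r₀ 0 τ₀ LinearIsometry.id y) := by
  have hx := radius_cyl_pos hr₀ τ₀ hy 0
  have hq := bilin_radiusSharp_cyl_neg_zero hr₀ h2M τ₀ hy
  have hΦ := contDiffAt_kerrCylUnitNormal_spin₂ M
    (q := ((0 : ℝ), kerrCylMap r₀ 0 τ₀ LinearIsometry.id y)) hx hq (n := 2)
  exact differentiableAt_partialField (Φ := fun q : ℝ × E4 ↦ kerrCylUnitNormal M q.1 q.2) hΦ
    (eventually_hasDerivAt_kerrCylUnitNormal_spin hr₀ h2M τ₀ hy)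

end Cylinder

end LiMei

/-! ### Schwarzschild atoms for the first-order spin fields -/

namespace Schwarzschild

variable {x : E4}

/-- The "swirl" pairing `ω_x(A) = x₂ A₁ − x₁ A₂ = r² δℓ_x(A)` (bilinear in `(x, A)`). [folklore] -/
def swirl (x A : E4) : ℝ := E4.spatial x 1 * E4.spatial A 0 - E4.spatial x 0 * E4.spatial A 1

/-- The derivative of `x ↦ ω_x(A)` (a constant covector). [folklore] -/
def swirlCLM (A : E4) : E4 →L[ℝ] ℝ := (E4.spatial A 0) • E4.dx 2 - (E4.spatial A 1) • E4.dx 1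

/-- `swirlCLM A U = ω_U(A)`. [folklore] -/
@[simp]
theorem swirlCLM_apply (A U : E4) : swirlCLM A U = swirl U A := by
  have hdx : ∀ (μ : Fin 4) (X : E4), E4.dx μ X = X μ := fun _ _ ↦ rfl
  have h1 : ∀ X : E4, E4.spatial X 0 = X 1 := fun _ ↦ rfl
  have h2 : ∀ X : E4, E4.spatial X 1 = X 2 := fun _ ↦ rfl
  simp only [swirlCLM, swirl, sub_apply, FunLike.coe_smul, Pi.smul_apply, smul_eq_mul, hdx, h1, h2]
  ring

/-- `x ↦ ω_x(A)` is linear, with derivative `swirlCLM A`. [folklore] -/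
theorem hasFDerivAt_swirl (x A : E4) : HasFDerivAt (fun x : E4 ↦ swirl x A) (swirlCLM A) x := by
  have h := (((E4.dx 2).hasFDerivAt (x := x)).mul_const (E4.spatial A 0)).sub
    (((E4.dx 1).hasFDerivAt (x := x)).mul_const (E4.spatial A 1))
  have hfun : (fun x : E4 ↦ swirl x A) = fun x ↦ E4.dx 2 x * E4.spatial A 0 - E4.dx 1 x * E4.spatial A 1 :=
    rfl
  rw [hfun]
  refine h.congr_fderiv ?_
  ext U
  simp only [swirlCLM, sub_apply, FunLike.coe_smul, Pi.smul_apply, smul_eq_mul]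

/-- `δℓ_x(A) = ω_x(A)/r²`. [folklore] -/
theorem spinNullCovector_eq_swirl (x A : E4) :
    Kerr.spinNullCovector x A = swirl x A / E4.spatialNorm x ^ 2 := by
  rw [Kerr.spinNullCovector_apply, Kerr.radius_zero_left, swirl]
  simp only [E4.spatial_apply, Fin.succ_zero_eq_one, Fin.succ_one_eq_two]

/-- **The first-order spin term of the metric in Schwarzschild atoms**:
`σ_x(A, B) = (2M/r³)(ℓ(A) ω(B) + ω(A) ℓ(B))` off the time axis. [cite: KerrSchild1965, §3] -/
theorem spinMetric_zero_eq (M : ℝ) (hx : E4.spatial x ≠ 0) (A B : E4) :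
    Kerr.spinMetric M x A B =
      2 * M / E4.spatialNorm x ^ 3 * (ell x A * swirl x B + swirl x A * ell x B) := by
  have hr : E4.spatialNorm x ≠ 0 := by
    rw [E4.spatialNorm]; exact norm_ne_zero_iff.2 hx
  rw [Kerr.spinMetric_apply, Kerr.scalarH_zero_spin M hr, nullCovector_zero_eq_ell,
    nullCovector_zero_eq_ell, spinNullCovector_eq_swirl, spinNullCovector_eq_swirl]
  field_simp

/-- The directional derivative `∂_U σ(A, B)` of the first-order spin term in atoms. [folklore] -/
def dSig (M : ℝ) (x U A B : E4) : ℝ :=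
  -(2 * M * 3) / E4.spatialNorm x ^ 5 * sdot x U * (ell x A * swirl x B + swirl x A * ell x B) +
    2 * M / E4.spatialNorm x ^ 3 *
      (dEll x U A * swirl x B + ell x A * swirl U B + (swirl U A * ell x B + swirl x A * dEll x U B))

/-- **The first derivatives of the first-order spin term**: `∂_U σ(A, B) = dSig M x U A B` off the
time axis (given differentiability of the field `σ` at `x`). [folklore] -/
theorem fderiv_spinMetric_apply (M : ℝ) (hx : E4.spatial x ≠ 0)
    (hd : DifferentiableAt ℝ (Kerr.spinMetric M) x) (U A B : E4) :
    fderiv ℝ (Kerr.spinMetric M) x U A B = dSig M x U A B := by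
  rw [← OpensChart.fderiv_apply₂ (Kerr.spinMetric M) hd]
  have heq : (fun y ↦ Kerr.spinMetric M y A B) =ᶠ[𝓝 x]
      fun y ↦ 2 * M / E4.spatialNorm y ^ 3 * (ell y A * swirl y B + swirl y A * ell y B) := by
    filter_upwards [isOpen_spatial_ne_zero.mem_nhds hx] with y hy
    exact spinMetric_zero_eq M hy A B
  rw [heq.fderiv_eq]
  have h : HasFDerivAt
      (fun y : E4 ↦ 2 * M / E4.spatialNorm y ^ 3 * (ell y A * swirl y B + swirl y A * ell y B)) _ x :=
    (hasFDerivAt_const_div_spatialNorm_pow (2 * M) hx 3).mul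
      (((hasFDerivAt_ell hx A).mul (hasFDerivAt_swirl x B)).add
        ((hasFDerivAt_swirl x A).mul (hasFDerivAt_ell hx B)))
  rw [h.fderiv]
  simp only [dSig, add_apply, FunLike.coe_smul, Pi.smul_apply, sdotCLM_apply, ellFD_apply,
    swirlCLM_apply, smul_eq_mul]
  push_cast
  ring

end Schwarzschild

namespace LiMei

/-! ### The closed forms on the Schwarzschild cylinder -/

/-- The generator of rotations about the spin axis on `E3`: `J u = (u₁, −u₀, 0)`. [folklore] -/
def spinTwist : E3 →L[ℝ] E3 :=
  LinearMap.toContinuousLinearMap (IsLinearMap.mk' (fun u : E3 ↦ WithLp.toLp 2 ![u 1, -u 0, 0]) (by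
    constructor
    · intro u u'
      ext i
      fin_cases i <;> simp [add_comm]
    · intro c u
      ext i
      fin_cases i <;> simp))

/-- Components of `J u`. [folklore] -/
theorem spinTwist_apply (u : E3) : spinTwist u = WithLp.toLp 2 ![u 1, -u 0, 0] := rfl

/-- `⟪J u, w⟫ = u₁ w₀ − u₀ w₁`. [folklore] -/
theorem inner_spinTwist_left (u w : E3) : ⟪spinTwist u, w⟫ = u 1 * w 0 - u 0 * w 1 := by
  rw [PiLp.inner_apply, Fin.sum_univ_three, spinTwist_apply]
  simp only [RCLike.inner_apply, conj_trivial]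
  simp
  ring

/-- `⟪w, J u⟫ = u₁ w₀ − u₀ w₁`. [folklore] -/
theorem inner_spinTwist_right (u w : E3) : ⟪w, spinTwist u⟫ = u 1 * w 0 - u 0 * w 1 := by
  rw [real_inner_comm, inner_spinTwist_left]

section SchwCyl

variable {M r₀ : ℝ} (hr₀ : 0 < r₀) (τ₀ : ℝ) {z : E3} (hz : z ≠ 0)
include hr₀ hz

/-- On the Schwarzschild cylinder, `g♯dr = (2M/r₀) ∂₀ + (1 − 2M/r₀)(0, z/‖z‖)`. [folklore] -/
theorem radiusSharp_zero_schwCyl :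
    Kerr.radiusSharp M 0 (schwCylMap r₀ τ₀ z) =
      (2 * M / r₀) • E4.basisVector 0 + (1 - 2 * M / r₀) • E4.spaceEmbed (‖z‖⁻¹ • z) := by
  have hn : ‖z‖ ≠ 0 := norm_ne_zero_iff.2 hz
  have hsp : E4.spatialNorm (schwCylMap r₀ τ₀ z) = r₀ := spatialNorm_schwCylMap hr₀ τ₀ hz
  have hsp' : E4.spatialNorm (schwCylMap r₀ τ₀ z) ≠ 0 := by rw [hsp]; exact hr₀.ne'
  have hr : Kerr.radius 0 (schwCylMap r₀ τ₀ z) = r₀ := by rw [Kerr.radius_zero_left, hsp]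
  have hry : Kerr.radius 0 (E4.ofTimeSpace 0 (E4.spatial (schwCylMap r₀ τ₀ z))) = r₀ := by
    rw [Kerr.radius_zero_left, E4.spatialNorm_ofTimeSpace, ← E4.spatialNorm, hsp]
  have hnormsp : ‖E4.spatial (schwCylMap r₀ τ₀ z)‖ = r₀ := hsp
  have hS : Kerr.blSigma 0 (E4.spatial (schwCylMap r₀ τ₀ z)) = r₀ ^ 2 := by
    unfold Kerr.blSigma
    rw [hry, hnormsp]
    ring
  have hH : Kerr.scalarH M 0 (schwCylMap r₀ τ₀ z) = M / r₀ := by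
    rw [Kerr.scalarH_zero_spin M hsp', hsp]
  -- components of the point
  have hxj : ∀ k : Fin 3, schwCylMap r₀ τ₀ z k.succ = r₀ / ‖z‖ * z k := fun k ↦ by
    rw [← E4.spatial_apply, spatial_schwCylMap, PiLp.smul_apply, smul_eq_mul]
  have hx1 : schwCylMap r₀ τ₀ z 1 = r₀ / ‖z‖ * z 0 := hxj 0
  have hx2 : schwCylMap r₀ τ₀ z 2 = r₀ / ‖z‖ * z 1 := hxj 1
  have hx3 : schwCylMap r₀ τ₀ z 3 = r₀ / ‖z‖ * z 2 := hxj 2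
  -- the null vector `ℓ♯ = (−1, x⃗/r₀)`
  have e0 : Kerr.nullVector 0 (schwCylMap r₀ τ₀ z) 0 = -1 := Kerr.nullVector_apply_zero 0 _
  have e1 : Kerr.nullVector 0 (schwCylMap r₀ τ₀ z) 1 = ‖z‖⁻¹ * z 0 := by
    rw [Kerr.nullVector_apply_one]
    simp only [Kerr.nullCovectorFun, hr, Fin.isValue, Matrix.cons_val_one, Matrix.cons_val_zero, hx1,
      hx2]
    field_simp
    ring
  have e2 : Kerr.nullVector 0 (schwCylMap r₀ τ₀ z) 2 = ‖z‖⁻¹ * z 1 := by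
    rw [Kerr.nullVector_apply_two]
    simp only [Kerr.nullCovectorFun, hr, Fin.isValue, Matrix.cons_val, hx1, hx2]
    field_simp
    ring
  have e3 : Kerr.nullVector 0 (schwCylMap r₀ τ₀ z) 3 = ‖z‖⁻¹ * z 2 := by
    rw [Kerr.nullVector_apply_three]
    simp only [Kerr.nullCovectorFun, hr, Fin.isValue, Matrix.cons_val, hx3]
    field_simp
  -- `∇r = x⃗/r₀ = z/‖z‖`
  have hgrad : ∀ j : Fin 3, Kerr.radiusGradVec 0 (E4.spatial (schwCylMap r₀ τ₀ z)) j = ‖z‖⁻¹ * z j := by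
    intro j
    rw [Kerr.radiusGradVec_apply, hry, hS, spatial_schwCylMap]
    simp only [PiLp.smul_apply, smul_eq_mul, ne_eq, OfNat.ofNat_ne_zero, not_false_eq_true, zero_pow,
      zero_mul, ite_self, add_zero]
    field_simp
  -- components of the embeddings
  have hsE : ∀ u : E3, E4.spaceEmbed u 0 = 0 ∧ E4.spaceEmbed u 1 = u 0 ∧ E4.spaceEmbed u 2 = u 1 ∧
      E4.spaceEmbed u 3 = u 2 := fun u ↦ ⟨rfl, rfl, rfl, rfl⟩
  have hb : E4.basisVector 0 0 = 1 ∧ E4.basisVector 0 1 = 0 ∧ E4.basisVector 0 2 = 0 ∧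
      E4.basisVector 0 3 = 0 := by
    simp [E4.basisVector]
  unfold Kerr.radiusSharp
  rw [hH]
  ext i
  fin_cases i
  · simp only [Fin.zero_eta, Fin.isValue, PiLp.sub_apply, PiLp.add_apply, PiLp.smul_apply,
      smul_eq_mul, (hsE _).1, e0, hb.1]
    ring
  · simp only [Fin.mk_one, Fin.isValue, PiLp.sub_apply, PiLp.add_apply, PiLp.smul_apply, smul_eq_mul,
      (hsE _).2.1, hgrad, e1, hb.2.1]
    ring
  · simp only [Fin.reduceFinMk, Fin.isValue, PiLp.sub_apply, PiLp.add_apply, PiLp.smul_apply,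
      smul_eq_mul, (hsE _).2.2.1, hgrad, e2, hb.2.2.1]
    ring
  · simp only [Fin.reduceFinMk, Fin.isValue, PiLp.sub_apply, PiLp.add_apply, PiLp.smul_apply,
      smul_eq_mul, (hsE _).2.2.2, hgrad, e3, hb.2.2.2]
    ring

/-- On the Schwarzschild cylinder, `g(g♯dr, g♯dr) = 1 − 2M/r₀`. [folklore] -/
theorem bilin_radiusSharp_self_zero_schwCyl :
    Kerr.bilin M 0 (schwCylMap r₀ τ₀ z) (Kerr.radiusSharp M 0 (schwCylMap r₀ τ₀ z))
      (Kerr.radiusSharp M 0 (schwCylMap r₀ τ₀ z)) = 1 - 2 * M / r₀ := by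
  have hx : 0 < Kerr.radius 0 (schwCylMap r₀ τ₀ z) := by rw [radius_schwCylMap hr₀ τ₀ hz]; exact hr₀
  have hsp : E4.spatialNorm (schwCylMap r₀ τ₀ z) = r₀ := spatialNorm_schwCylMap hr₀ τ₀ hz
  have hry : Kerr.radius 0 (E4.ofTimeSpace 0 (E4.spatial (schwCylMap r₀ τ₀ z))) = r₀ := by
    rw [Kerr.radius_zero_left, E4.spatialNorm_ofTimeSpace, ← E4.spatialNorm, hsp]
  have hnormsp : ‖E4.spatial (schwCylMap r₀ τ₀ z)‖ = r₀ := hsp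
  have hS : Kerr.blSigma 0 (E4.spatial (schwCylMap r₀ τ₀ z)) = r₀ ^ 2 := by
    unfold Kerr.blSigma
    rw [hry, hnormsp]
    ring
  rw [Kerr.bilin_radiusSharp_self M hx, radius_schwCylMap hr₀ τ₀ hz, hS]
  field_simp
  ring

/-- **The unit normal of the Kerr cylinders at `a = 0` is the Schwarzschild cylinder normal**
`ν = (2M/r₀ − 1)^{-1/2}((2M/r₀) ∂₀ + (1 − 2M/r₀)(0, z/‖z‖))` of `InteriorKerrGluingProofs`. [cite: LiMei2020, (4.1)] -/
theorem kerrCylUnitNormal_zero_schwCyl :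
    kerrCylUnitNormal M 0 (schwCylMap r₀ τ₀ z) = schwCylNormalRep M r₀ z := by
  unfold kerrCylUnitNormal schwCylNormalRep
  rw [bilin_radiusSharp_self_zero_schwCyl hr₀ τ₀ hz, radiusSharp_zero_schwCyl hr₀ τ₀ hz]
  congr 1
  ring_nf

/-- **The first-order spin term of the unit normal on the Schwarzschild cylinder**:
`ν₁ = −(2M/r₀ − 1)^{-1/2} (2M/r₀) r₀⁻¹ (0, J(z/‖z‖))`. [cite: LiMei2020, (4.2)] -/
theorem spinCylNormal_schwCyl :
    spinCylNormal M (schwCylMap r₀ τ₀ z) =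
      -((((Real.sqrt (2 * M / r₀ - 1))⁻¹ * (2 * M / r₀)) / r₀) •
        E4.spaceEmbed (spinTwist (‖z‖⁻¹ • z))) := by
  have hn : ‖z‖ ≠ 0 := norm_ne_zero_iff.2 hz
  have hsp : E4.spatialNorm (schwCylMap r₀ τ₀ z) = r₀ := spatialNorm_schwCylMap hr₀ τ₀ hz
  have hsp' : E4.spatialNorm (schwCylMap r₀ τ₀ z) ≠ 0 := by rw [hsp]; exact hr₀.ne'
  have hr : Kerr.radius 0 (schwCylMap r₀ τ₀ z) = r₀ := by rw [Kerr.radius_zero_left, hsp]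
  have hxj : ∀ k : Fin 3, schwCylMap r₀ τ₀ z k.succ = r₀ / ‖z‖ * z k := fun k ↦ by
    rw [← E4.spatial_apply, spatial_schwCylMap, PiLp.smul_apply, smul_eq_mul]
  unfold spinCylNormal
  rw [bilin_radiusSharp_self_zero_schwCyl hr₀ τ₀ hz, Kerr.scalarH_zero_spin M hsp', hsp, neg_sub]
  have hvec : Kerr.spinNullVector (schwCylMap r₀ τ₀ z) = r₀⁻¹ • E4.spaceEmbed (spinTwist (‖z‖⁻¹ • z)) := by
    have h1 : schwCylMap r₀ τ₀ z 1 = r₀ / ‖z‖ * z 0 := hxj 0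
    have h2 : schwCylMap r₀ τ₀ z 2 = r₀ / ‖z‖ * z 1 := hxj 1
    have hsE : ∀ u : E3, E4.spaceEmbed u 0 = 0 ∧ E4.spaceEmbed u 1 = u 0 ∧ E4.spaceEmbed u 2 = u 1 ∧
        E4.spaceEmbed u 3 = u 2 := fun u ↦ ⟨rfl, rfl, rfl, rfl⟩
    ext i
    fin_cases i
    · simp [Kerr.spinNullVector, Kerr.spinNullCovectorFun]
    · simp only [Kerr.spinNullVector, Kerr.spinNullCovectorFun, Fin.mk_one, Fin.isValue,
        Matrix.cons_val_one, Matrix.cons_val_zero, hr, h2, PiLp.smul_apply, smul_eq_mul, (hsE _).2.1,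
        spinTwist_apply]
      field_simp
    · simp only [Kerr.spinNullVector, Kerr.spinNullCovectorFun, Fin.reduceFinMk, Fin.isValue,
        Matrix.cons_val, hr, h1, PiLp.smul_apply, smul_eq_mul, (hsE _).2.2.1, spinTwist_apply]
      simp
      field_simp
    · simp only [Kerr.spinNullVector, Kerr.spinNullCovectorFun, Fin.reduceFinMk, Fin.isValue,
        Matrix.cons_val, PiLp.smul_apply, smul_eq_mul, (hsE _).2.2.2, spinTwist_apply]
      simp
  rw [hvec, smul_smul]
  congr 2
  field_simp

end SchwCyl

section CylinderEval

variable {M r₀ : ℝ} (hr₀ : 0 < r₀) (h2M : r₀ < 2 * M) (τ₀ : ℝ) {y : E3} (hy : y ≠ 0)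
include hr₀ h2M hy

omit h2M in
/-- The frame at `a = 0`. [folklore] -/
theorem kerrCylDeriv_zero_id (u : E3) : kerrCylDeriv r₀ 0 LinearIsometry.id y u = schwCylDeriv r₀ y u := by
  rw [kerrCylDeriv_zero_spin hr₀.le _ hy]; rfl

/-- `∂_{dψ v} n₀ = Dν(y) v` on the cylinder (`InteriorKerrGluingProofs.schwCylNormalDeriv`). [cite: LiMei2020, (4.1)] -/
theorem fderiv_kerrCylUnitNormal_zero_cyl (v : E3) :
    fderiv ℝ (kerrCylUnitNormal M 0) (kerrCylMap r₀ 0 τ₀ LinearIsometry.id y)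
        (kerrCylDeriv r₀ 0 LinearIsometry.id y v) = schwCylNormalDeriv M r₀ y v := by
  rw [← (eventually_fderiv_unitNormal_comp hr₀ h2M τ₀ hy v).self_of_nhds]
  have hev : (fun z : E3 ↦ kerrCylUnitNormal M 0 (kerrCylMap r₀ 0 τ₀ LinearIsometry.id z)) =ᶠ[𝓝 y]
      schwCylNormalRep M r₀ := by
    filter_upwards [isOpen_ne.mem_nhds hy] with z hz
    rw [kerrCylMap_zero_id hr₀.le τ₀ hz]
    exact kerrCylUnitNormal_zero_schwCyl hr₀ τ₀ hz
  rw [hev.fderiv_eq, fderiv_schwCylNormalRep M r₀ hy]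

/-- `∂_{dψ v} ν₁ = −(2M/r₀ − 1)^{-1/2}(2M/r₀) r₀⁻¹ (0, J(d(y/‖y‖) v))` on the cylinder. [cite: LiMei2020, (4.2)] -/
theorem fderiv_spinCylNormal_cyl (v : E3) :
    fderiv ℝ (spinCylNormal M) (kerrCylMap r₀ 0 τ₀ LinearIsometry.id y)
        (kerrCylDeriv r₀ 0 LinearIsometry.id y v) =
      -((((Real.sqrt (2 * M / r₀ - 1))⁻¹ * (2 * M / r₀)) / r₀) •
        E4.spaceEmbed (spinTwist (tanVec y v))) := by
  have hd := differentiableAt_spinCylNormal_cyl hr₀ h2M τ₀ hy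
  have hψ := hasFDerivAt_kerrCylMap r₀ 0 τ₀ LinearIsometry.id hy
  have hcomp : HasFDerivAt (fun z : E3 ↦ spinCylNormal M (kerrCylMap r₀ 0 τ₀ LinearIsometry.id z))
      ((fderiv ℝ (spinCylNormal M) (kerrCylMap r₀ 0 τ₀ LinearIsometry.id y)).comp
        (kerrCylDeriv r₀ 0 LinearIsometry.id y)) y :=
    hd.hasFDerivAt.comp y hψ
  -- the closed form near `y` and its derivative
  set κ : ℝ := ((Real.sqrt (2 * M / r₀ - 1))⁻¹ * (2 * M / r₀)) / r₀ with hκ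
  have hev : (fun z : E3 ↦ spinCylNormal M (kerrCylMap r₀ 0 τ₀ LinearIsometry.id z)) =ᶠ[𝓝 y]
      fun z ↦ -(κ • E4.spaceEmbed (spinTwist ((‖z‖ ^ 1)⁻¹ • z))) := by
    filter_upwards [isOpen_ne.mem_nhds hy] with z hz
    rw [kerrCylMap_zero_id hr₀.le τ₀ hz, pow_one]
    exact spinCylNormal_schwCyl hr₀ τ₀ hz
  have h1 : HasFDerivAt (fun z : E3 ↦ (‖z‖ ^ 1)⁻¹ • z)
      ((‖y‖ ^ 1)⁻¹ • ContinuousLinearMap.id ℝ E3 +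
        (((-(1 : ℕ) : ℝ) / ‖y‖ ^ (1 + 2)) • E3.covec y).smulRight y) y :=
    (Kerr.hasFDerivAt_inv_norm_pow hy 1).smul (hasFDerivAt_id y)
  have h2 := ((E4.spaceEmbed.comp spinTwist).hasFDerivAt.comp y h1).const_smul κ
  have h3 : HasFDerivAt (fun z : E3 ↦ -(κ • E4.spaceEmbed (spinTwist ((‖z‖ ^ 1)⁻¹ • z))))
      (-(κ • ((E4.spaceEmbed.comp spinTwist).comp ((‖y‖ ^ 1)⁻¹ • ContinuousLinearMap.id ℝ E3 +
        (((-(1 : ℕ) : ℝ) / ‖y‖ ^ (1 + 2)) • E3.covec y).smulRight y)))) y := h2.neg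
  have key := congrArg (fun L : E3 →L[ℝ] E4 ↦ L v) (hcomp.unique (h3.congr_of_eventuallyEq hev))
  simp only [ContinuousLinearMap.comp_apply, neg_apply, FunLike.coe_smul, Pi.smul_apply] at key
  rw [key]
  simp only [pow_one, Nat.cast_one, add_apply, FunLike.coe_smul, Pi.smul_apply,
    ContinuousLinearMap.id_apply, ContinuousLinearMap.smulRight_apply, E3.covec_apply, tanVec]
  norm_num

/-- **Li–Mei (4.2), second line: the first-order spin term of the second fundamental form of the
Kerr cylinders.** For `0 < r₀ < 2M`, `y ≠ 0`, the closed form `cylKRep M a r₀ τ₀ 1 y v w` of the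
second fundamental form of the standard Kerr cylinder (future, `r`-decreasing unit normal) is
differentiable in the spin at `a = 0` with derivative
`M (2M/r₀ − 1)^{1/2} r₀⁻² ‖y‖⁻³ ((y₁v₀ − y₀v₁)⟪y, w⟫ + ⟪y, v⟫(y₁w₀ − y₀w₁))`, i.e. Li–Mei's
`−2 m r₀⁻² sin²θ (2m/r₀ − 1)^{1/2} dt dφ` read through `dψ`. [cite: LiMei2020, (4.2)] -/
theorem hasDerivAt_cylKRep_spin (v w : E3) :
    HasDerivAt (fun a : ℝ ↦ cylKRep M a r₀ τ₀ LinearIsometry.id y v w)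
      (M * Real.sqrt (2 * M / r₀ - 1) / (r₀ ^ 2 * ‖y‖ ^ 3) *
        ((y 1 * v 0 - y 0 * v 1) * ⟪y, w⟫ + ⟪y, v⟫ * (y 1 * w 0 - y 0 * w 1))) 0 := by
  refine (hasDerivAt_cylKRep_spin_abstract hr₀ h2M τ₀ hy v w).congr_deriv ?_
  have hdσ := differentiableAt_spinMetric_cyl (M := M) hr₀ τ₀ hy
  rw [fderiv_kerrCylUnitNormal_zero_cyl hr₀ h2M τ₀ hy v, fderiv_spinCylNormal_cyl hr₀ h2M τ₀ hy v]
  rw [kerrCylMap_zero_id hr₀.le τ₀ hy] at hdσ ⊢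
  rw [kerrCylUnitNormal_zero_schwCyl hr₀ τ₀ hy, spinCylNormal_schwCyl hr₀ τ₀ hy]
  simp only [kerrCylDeriv_zero_id hr₀ hy]
  -- the atoms at the cylinder point
  have hn : ‖y‖ ≠ 0 := norm_ne_zero_iff.2 hy
  have hμ : 0 < 2 * M / r₀ - 1 := by
    rw [sub_pos, lt_div_iff₀ hr₀]; linarith
  have hs0 : Real.sqrt (2 * M / r₀ - 1) ≠ 0 := (Real.sqrt_pos.2 hμ).ne'
  have hsq : Real.sqrt (2 * M / r₀ - 1) = (2 * M / r₀ - 1) * (Real.sqrt (2 * M / r₀ - 1))⁻¹ := by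
    rw [eq_mul_inv_iff_mul_eq₀ hs0, Real.mul_self_sqrt hμ.le]
  have hspv : E4.spatial (schwCylMap r₀ τ₀ y) ≠ 0 := spatial_schwCylMap_ne_zero hr₀.ne' τ₀ hy
  have hsp : E4.spatialNorm (schwCylMap r₀ τ₀ y) = r₀ := spatialNorm_schwCylMap hr₀ τ₀ hy
  have hsp' : E4.spatialNorm (schwCylMap r₀ τ₀ y) ≠ 0 := by rw [hsp]; exact hr₀.ne'
  have hsE : ∀ u : E3, E4.spaceEmbed u 0 = 0 := fun u ↦ rfl
  conv_rhs => rw [hsq]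
  simp only [Schwarzschild.fderiv_bilin_zero_spin_apply M hspv,
    Schwarzschild.fderiv_spinMetric_apply M hspv hdσ, Schwarzschild.spinMetric_zero_eq M hspv,
    Kerr.bilin_zero_spin_apply M hsp']
  simp only [Schwarzschild.dG, Schwarzschild.dSig, Schwarzschild.dEll, Schwarzschild.ell,
    Schwarzschild.sdot, Schwarzschild.swirl, hsp, schwCylDeriv_apply_zero, spatial_schwCylDeriv,
    spatial_schwCylMap, schwCylNormalRep_apply_zero, spatial_schwCylNormalRep,
    schwCylNormalDeriv_apply_zero, spatial_schwCylNormalDeriv, map_neg, map_smul,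
    E4.spatial_spaceEmbed, PiLp.neg_apply, PiLp.smul_apply, PiLp.add_apply, smul_eq_mul, hsE,
    inner_add_left, inner_add_right, inner_smul_left, inner_smul_right, inner_neg_left,
    inner_neg_right, inner_spinTwist_left, inner_spinTwist_right, real_inner_self_eq_norm_sq,
    real_inner_comm v y, real_inner_comm w y, real_inner_comm w v, conj_trivial, tanVec_apply,
    mul_zero, neg_zero, zero_mul, mul_neg, neg_mul]
  set s := Real.sqrt (2 * M / r₀ - 1) with hs_def
  field_simp
  ring

end CylinderEval

/-! ### Transfer to the datum `cylK₀` and to rotated frames -/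

/-- **Li–Mei (4.2), second line, for the second fundamental form `cylK₀` of the standard Kerr
cylinder datum** (`KerrCylinderDatum.lean`): for `0 < r₀ < 2M` and `y ≠ 0`,
`a ↦ cylK₀ M a r₀ τ₀ 1 y v w` has derivative
`M (2M/r₀ − 1)^{1/2} r₀⁻² ‖y‖⁻³ ((y₁v₀ − y₀v₁)⟪y, w⟫ + ⟪y, v⟫(y₁w₀ − y₀w₁))` at `a = 0`
(`cylK₀ = cylKRep` for `Δ_{M,a}(r₀) < 0`, which holds for small `a`). [cite: LiMei2020, (4.2)] -/
theorem hasDerivAt_cylK₀_spin [Kerr.Facts] {M r₀ : ℝ} (hr₀ : 0 < r₀) (h2M : r₀ < 2 * M) (τ₀ : ℝ)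
    {y : E3} (hy : y ≠ 0) (v w : E3) :
    HasDerivAt (fun a : ℝ ↦ cylK₀ M a hr₀ τ₀ LinearIsometry.id y v w)
      (M * Real.sqrt (2 * M / r₀ - 1) / (r₀ ^ 2 * ‖y‖ ^ 3) *
        ((y 1 * v 0 - y 0 * v 1) * ⟪y, w⟫ + ⟪y, v⟫ * (y 1 * w 0 - y 0 * w 1))) 0 := by
  have hΔ0 : r₀ ^ 2 - 2 * M * r₀ + (0 : ℝ) ^ 2 < 0 := by nlinarith
  have hc : ContinuousAt (fun a : ℝ ↦ r₀ ^ 2 - 2 * M * r₀ + a ^ 2) 0 := by fun_prop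
  have hev : (fun a : ℝ ↦ cylK₀ M a hr₀ τ₀ LinearIsometry.id y v w) =ᶠ[𝓝 0]
      fun a ↦ cylKRep M a r₀ τ₀ LinearIsometry.id y v w := by
    filter_upwards [hc.eventually (gt_mem_nhds hΔ0)] with a ha
    exact cylK₀_apply_eq_cylKRep hr₀ ha τ₀ _ hy v w
  exact (hasDerivAt_cylKRep_spin hr₀ h2M τ₀ hy v w).congr_of_eventuallyEq hev

/-- The same for a rotated frame `R`: the first-order term is evaluated at `(Ry, Rv, Rw)`
(`cylK₀_isometry`). [cite: LiMei2020, (4.2)] -/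
theorem hasDerivAt_cylK₀_spin_isometry [Kerr.Facts] {M r₀ : ℝ} (hr₀ : 0 < r₀) (h2M : r₀ < 2 * M)
    (τ₀ : ℝ) (R : E3 →ₗᵢ[ℝ] E3) {y : E3} (hy : y ≠ 0) (v w : E3) :
    HasDerivAt (fun a : ℝ ↦ cylK₀ M a hr₀ τ₀ R y v w)
      (M * Real.sqrt (2 * M / r₀ - 1) / (r₀ ^ 2 * ‖y‖ ^ 3) *
        ((R y 1 * R v 0 - R y 0 * R v 1) * ⟪y, w⟫ + ⟪y, v⟫ * (R y 1 * R w 0 - R y 0 * R w 1))) 0 := by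
  have hΔ0 : r₀ ^ 2 - 2 * M * r₀ + (0 : ℝ) ^ 2 < 0 := by nlinarith
  have hc : ContinuousAt (fun a : ℝ ↦ r₀ ^ 2 - 2 * M * r₀ + a ^ 2) 0 := by fun_prop
  have hev : (fun a : ℝ ↦ cylK₀ M a hr₀ τ₀ R y v w) =ᶠ[𝓝 0]
      fun a ↦ cylK₀ M a hr₀ τ₀ LinearIsometry.id (R y) (R v) (R w) := by
    filter_upwards [hc.eventually (gt_mem_nhds hΔ0)] with a ha
    exact cylK₀_isometry hr₀ ha τ₀ R hy v w
  have h := hasDerivAt_cylK₀_spin hr₀ h2M τ₀ (isometry_apply_ne_zero R hy) (R v) (R w)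
  rw [LinearIsometry.norm_map, LinearIsometry.inner_map_map, LinearIsometry.inner_map_map] at h
  exact h.congr_of_eventuallyEq hev

end LiMei

end Literature.Geometry.Lorentzian

end
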